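import Summits.Ventures.PercRepro.RankLevelSetLevelSixHeavyCellSq39U
import Summits.Ventures.PercRepro.RankLevelSetLevelSixArithHeavySq39UA
import Summits.Ventures.PercRepro.RankLevelSetLevelSixArithHeavySq39UB
import Summits.Ventures.PercRepro.RankLevelSetLevelSixArithHeavySq39UC
import Summits.Ventures.PercRepro.RankLevelSetLevelSixArithHeavySq39UD
import Summits.Ventures.PercRepro.RankLevelSetLevelSixArithHeavySq39UE
import Summits.Ventures.PercRepro.RankLevelSetLevelSixArithHeavySq39UF
import Summits.Ventures.PercRepro.RankLevelSetLevelSixArithHeavySq39UG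
import Summits.Ventures.PercRepro.RankLevelSetLevelSixArithHeavySq39UH
import Summits.Ventures.PercRepro.RankLevelSetLevelSixArithHeavySq39UI
import Summits.Ventures.PercRepro.S3SixWindow
import Summits.Ventures.PercRepro.RankLevelSetCoreSixLowSelf
import Summits.Ventures.PercRepro.RankLevelSetLevelFivePart

/-!
# PercRepro — THEOREM C₆ ON THE FLAT BOUNDS `f(6) ≤ 39`, `f(5) ≤ 19`, LEMMA T⁺⁺, THE FLAT-COUNT TAIL AND THE UNIQUE HEAVY
FLAT: LEVEL `5` AT `38` ⇒ C-025 AT LEVEL `6` FOR EVERY `p ≥ 39`, AND `c025_six_large_thirty_nine (39 ≤ p) : RLS M p 6`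
UNCONDITIONAL (p8 g3, S3)

`proofs/SUBCLAIM-S3-p8.md` §3k. The 40 chain of §3i (`c025_six_large_forty`) with THE UNIQUE HEAVY FLAT (RankLevelSetDepCountHeavyU:
when `2ν₁ ≥ d + 15` two heavy rank-`6` flats would meet in a rank-`≤ 5` set of nullity `> 14`, so `|UG| ≤ min(39, 6 + d)` in place
of the union bound `6 + (j + 1)d − jν₁` — `2^{39}` against `2^{55}` at `(39, 41)`); the other levers as in §3i: p1's LEMMA T⁺⁺
(`s₃ ≤ (d² − 3d + 8)/2`, S1TrianglePlusPlus) and the FLAT-COUNT TAIL (the rank-`≤ 6` sets `≤ Σ_{j ≤ 19} C(n, j) +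
2^{33}·Σ_{j ≤ 6} C(n, j)`, coranks 22 … 50). Every core cell `(p, 7 ≤ d ≤ 50)` at `p ≥ 39` by the split cell
`c025_core_six_heavy_cell_sq39u` (the unique flat from `d = 30`; no heavy-free cell is needed), with the per-corank parameters
of RankLevelSetLevelSixArithHeavySq39UA … I (`c025_core_six_bounded_corank_heavy_sq39u`); the cells `d ≥ 51` by `c025_core_six_thirtynine_thirtyeight'`
(`38 ≤ p`, RankLevelSetCoreSixLowSelf); level `5` for `p ≥ 38` gives level `6` for `p ≥ 39` (`c025_six_of_five_heavy_sq39u`: rank `39` by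
`rls_six_at_of_core`, ranks `≥ 40` by `rls_succ_large`). On p7's `c025_five_large_part33 (33 ≤ p)` (RankLevelSetLevelFivePart)
this is **`c025_six_large_thirty_nine (39 ≤ p)`**, unconditional over the tree. At `38` the cells `d = 8, 9` fail (the `s₃`, `s₄`
bounds and the independent term `C(n, 6)`); with p1's LEMMA T4⁺ they close and `38` follows. Axioms: standard.
-/

open scoped Matroid

namespace PercRepro

namespace ThmN

open Set

variable {α : Type}

/-- **The `e`-free core at level `6`, corank `7 ≤ d ≤ 50`, rank `p ≥ 39`** (flat bounds `39 / 19`, LEMMA T⁺⁺, square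
multiplicity, rational tails in the nullity-cap or the flat-count form, the unique heavy flat from `d = 30`). -/
theorem c025_core_six_bounded_corank_heavy_sq39u (M : Matroid α) [M.Finite] (p d : ℕ) (hp : 39 ≤ p) (hd7 : 7 ≤ d)
    (hd50 : d ≤ 50) (hR : M.eRank = (p : ℕ∞)) (hn : M.E.ncard = p + d)
    (hfree : ∀ e ∈ M.E, ∃ A ⊆ M.E \ {e}, e ∉ M.closure A ∧ e ∉ M.closure ((M.E \ {e}) \ A)) :
    RLS M p 6 := by
  interval_cases d
  · exact c025_core_six_heavy_cell_sq39u M p 7 7 1 1 13 12 0 440946 1000 13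
      (by norm_num) (by norm_num) (by norm_num) (by norm_num) (by norm_num) (by norm_num) (by norm_num)
      (by norm_num [cnull]) (by norm_num [cnull]) (Or.inl (by norm_num)) (Or.inl (by norm_num)) (Or.inl (by norm_num)) (by norm_num) (by norm_num) (by norm_num)
      (Or.inl (tail_six_heavy_sq39U_7 (p + 7) (by omega))) hR hn hfree (level_six_poly_heavy_sq39U_7 p hp)
  · exact c025_core_six_heavy_cell_sq39u M p 8 7 2 1 16 14 0 251627 1000 14
      (by norm_num) (by norm_num) (by norm_num) (by norm_num) (by norm_num) (by norm_num) (by norm_num)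
      (by norm_num [cnull]) (by norm_num [cnull]) (Or.inl (by norm_num)) (Or.inl (by norm_num)) (Or.inl (by norm_num)) (by norm_num) (by norm_num) (by norm_num)
      (Or.inl (tail_six_heavy_sq39U_8 (p + 8) (by omega))) hR hn hfree (level_six_poly_heavy_sq39U_8 p hp)
  · exact c025_core_six_heavy_cell_sq39u M p 9 7 2 1 19 16 0 150392 1000 15
      (by norm_num) (by norm_num) (by norm_num) (by norm_num) (by norm_num) (by norm_num) (by norm_num)
      (by norm_num [cnull]) (by norm_num [cnull]) (Or.inl (by norm_num)) (Or.inl (by norm_num)) (Or.inl (by norm_num)) (by norm_num) (by norm_num) (by norm_num)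
      (Or.inl (tail_six_heavy_sq39U_9 (p + 9) (by omega))) hR hn hfree (level_six_poly_heavy_sq39U_9 p hp)
  · exact c025_core_six_heavy_cell_sq39u M p 10 7 2 1 22 18 0 93753 1000 16
      (by norm_num) (by norm_num) (by norm_num) (by norm_num) (by norm_num) (by norm_num) (by norm_num)
      (by norm_num [cnull]) (by norm_num [cnull]) (Or.inl (by norm_num)) (Or.inl (by norm_num)) (Or.inl (by norm_num)) (by norm_num) (by norm_num) (by norm_num)
      (Or.inl (tail_six_heavy_sq39U_10 (p + 10) (by omega))) hR hn hfree (level_six_poly_heavy_sq39U_10 p hp)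
  · exact c025_core_six_heavy_cell_sq39u M p 11 8 2 1 23 19 0 60736 1000 17
      (by norm_num) (by norm_num) (by norm_num) (by norm_num) (by norm_num) (by norm_num) (by norm_num)
      (by norm_num [cnull]) (by norm_num [cnull]) (Or.inl (by norm_num)) (Or.inl (by norm_num)) (Or.inl (by norm_num)) (by norm_num) (by norm_num) (by norm_num)
      (Or.inl (tail_six_heavy_sq39U_11 (p + 11) (by omega))) hR hn hfree (level_six_poly_heavy_sq39U_11 p hp)
  · exact c025_core_six_heavy_cell_sq39u M p 12 8 2 1 26 21 0 40756 1000 18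
      (by norm_num) (by norm_num) (by norm_num) (by norm_num) (by norm_num) (by norm_num) (by norm_num)
      (by norm_num [cnull]) (by norm_num [cnull]) (Or.inl (by norm_num)) (Or.inl (by norm_num)) (Or.inl (by norm_num)) (by norm_num) (by norm_num) (by norm_num)
      (Or.inl (tail_six_heavy_sq39U_12 (p + 12) (by omega))) hR hn hfree (level_six_poly_heavy_sq39U_12 p hp)
  · exact c025_core_six_heavy_cell_sq39u M p 13 10 1 1 22 18 0 28247 1000 19
      (by norm_num) (by norm_num) (by norm_num) (by norm_num) (by norm_num) (by norm_num) (by norm_num)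
      (by norm_num [cnull]) (by norm_num [cnull]) (Or.inl (by norm_num)) (Or.inr (Or.inl ⟨by norm_num, by norm_num⟩)) (Or.inl (by norm_num)) (by norm_num) (by norm_num) (by norm_num)
      (Or.inl (tail_six_heavy_sq39U_13 (p + 13) (by omega))) hR hn hfree (level_six_poly_heavy_sq39U_13 p hp)
  · exact c025_core_six_heavy_cell_sq39u M p 14 11 1 1 23 19 0 20166 1000 20
      (by norm_num) (by norm_num) (by norm_num) (by norm_num) (by norm_num) (by norm_num) (by norm_num)
      (by norm_num [cnull]) (by norm_num [cnull]) (Or.inl (by norm_num)) (Or.inr (Or.inl ⟨by norm_num, by norm_num⟩)) (Or.inl (by norm_num)) (by norm_num) (by norm_num) (by norm_num)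
      (Or.inl (tail_six_heavy_sq39U_14 (p + 14) (by omega))) hR hn hfree (level_six_poly_heavy_sq39U_14 p hp)
  · exact c025_core_six_heavy_cell_sq39u M p 15 11 1 1 25 19 0 14796 1000 21
      (by norm_num) (by norm_num) (by norm_num) (by norm_num) (by norm_num) (by norm_num) (by norm_num)
      (by norm_num [cnull]) (by norm_num [cnull]) (Or.inl (by norm_num)) (Or.inr (Or.inl ⟨by norm_num, by norm_num⟩)) (Or.inl (by norm_num)) (by norm_num) (by norm_num) (by norm_num)
      (Or.inl (tail_six_heavy_sq39U_15 (p + 15) (by omega))) hR hn hfree (level_six_poly_heavy_sq39U_15 p hp)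
  · exact c025_core_six_heavy_cell_sq39u M p 16 12 1 1 26 19 0 11131 1000 22
      (by norm_num) (by norm_num) (by norm_num) (by norm_num) (by norm_num) (by norm_num) (by norm_num)
      (by norm_num [cnull]) (by norm_num [cnull]) (Or.inl (by norm_num)) (Or.inr (Or.inl ⟨by norm_num, by norm_num⟩)) (Or.inl (by norm_num)) (by norm_num) (by norm_num) (by norm_num)
      (Or.inl (tail_six_heavy_sq39U_16 (p + 16) (by omega))) hR hn hfree (level_six_poly_heavy_sq39U_16 p hp)
  · exact c025_core_six_heavy_cell_sq39u M p 17 12 1 1 28 19 0 8570 1000 23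
      (by norm_num) (by norm_num) (by norm_num) (by norm_num) (by norm_num) (by norm_num) (by norm_num)
      (by norm_num [cnull]) (by norm_num [cnull]) (Or.inl (by norm_num)) (Or.inr (Or.inl ⟨by norm_num, by norm_num⟩)) (Or.inl (by norm_num)) (by norm_num) (by norm_num) (by norm_num)
      (Or.inl (tail_six_heavy_sq39U_17 (p + 17) (by omega))) hR hn hfree (level_six_poly_heavy_sq39U_17 p hp)
  · exact c025_core_six_heavy_cell_sq39u M p 18 13 1 1 29 19 0 6739 1000 24
      (by norm_num) (by norm_num) (by norm_num) (by norm_num) (by norm_num) (by norm_num) (by norm_num)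
      (by norm_num [cnull]) (by norm_num [cnull]) (Or.inl (by norm_num)) (Or.inr (Or.inl ⟨by norm_num, by norm_num⟩)) (Or.inl (by norm_num)) (by norm_num) (by norm_num) (by norm_num)
      (Or.inl (tail_six_heavy_sq39U_18 (p + 18) (by omega))) hR hn hfree (level_six_poly_heavy_sq39U_18 p hp)
  · exact c025_core_six_heavy_cell_sq39u M p 19 13 1 1 31 19 0 5404 1000 25
      (by norm_num) (by norm_num) (by norm_num) (by norm_num) (by norm_num) (by norm_num) (by norm_num)
      (by norm_num [cnull]) (by norm_num [cnull]) (Or.inl (by norm_num)) (Or.inr (Or.inl ⟨by norm_num, by norm_num⟩)) (Or.inl (by norm_num)) (by norm_num) (by norm_num) (by norm_num)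
      (Or.inl (tail_six_heavy_sq39U_19 (p + 19) (by omega))) hR hn hfree (level_six_poly_heavy_sq39U_19 p hp)
  · exact c025_core_six_heavy_cell_sq39u M p 20 14 1 1 32 19 0 4411 1000 26
      (by norm_num) (by norm_num) (by norm_num) (by norm_num) (by norm_num) (by norm_num) (by norm_num)
      (by norm_num [cnull]) (by norm_num [cnull]) (Or.inl (by norm_num)) (Or.inr (Or.inl ⟨by norm_num, by norm_num⟩)) (Or.inl (by norm_num)) (by norm_num) (by norm_num) (by norm_num)
      (Or.inl (tail_six_heavy_sq39U_20 (p + 20) (by omega))) hR hn hfree (level_six_poly_heavy_sq39U_20 p hp)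
  · exact c025_core_six_heavy_cell_sq39u M p 21 14 1 1 34 19 0 3661 1000 27
      (by norm_num) (by norm_num) (by norm_num) (by norm_num) (by norm_num) (by norm_num) (by norm_num)
      (by norm_num [cnull]) (by norm_num [cnull]) (Or.inl (by norm_num)) (Or.inr (Or.inl ⟨by norm_num, by norm_num⟩)) (Or.inl (by norm_num)) (by norm_num) (by norm_num) (by norm_num)
      (Or.inl (tail_six_heavy_sq39U_21 (p + 21) (by omega))) hR hn hfree (level_six_poly_heavy_sq39U_21 p hp)
  · exact c025_core_six_heavy_cell_sq39u M p 22 15 1 1 35 0 0 3950 1000 28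
      (by norm_num) (by norm_num) (by norm_num) (by norm_num) (by norm_num) (by norm_num) (by norm_num)
      (by norm_num [cnull]) (by norm_num [cnull]) (Or.inl (by norm_num)) (Or.inr (Or.inr (by norm_num))) (Or.inl (by norm_num)) (by norm_num) (by norm_num) (by norm_num)
      (Or.inr (tail_six_heavy_sq39U_22 (p + 22) (by omega))) hR hn hfree (level_six_poly_heavy_sq39U_22 p hp)
  · exact c025_core_six_heavy_cell_sq39u M p 23 15 1 1 37 0 0 6361 1000 29
      (by norm_num) (by norm_num) (by norm_num) (by norm_num) (by norm_num) (by norm_num) (by norm_num)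
      (by norm_num [cnull]) (by norm_num [cnull]) (Or.inl (by norm_num)) (Or.inr (Or.inr (by norm_num))) (Or.inl (by norm_num)) (by norm_num) (by norm_num) (by norm_num)
      (Or.inr (tail_six_heavy_sq39U_23 (p + 23) (by omega))) hR hn hfree (level_six_poly_heavy_sq39U_23 p hp)
  · exact c025_core_six_heavy_cell_sq39u M p 24 16 1 1 38 0 1 9091 1000 30
      (by norm_num) (by norm_num) (by norm_num) (by norm_num) (by norm_num) (by norm_num) (by norm_num)
      (by norm_num [cnull]) (by norm_num [cnull]) (Or.inl (by norm_num)) (Or.inr (Or.inr (by norm_num))) (Or.inr rfl) (by norm_num) (by norm_num) (by norm_num)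
      (Or.inr (tail_six_heavy_sq39U_24 (p + 24) (by omega))) hR hn hfree (level_six_poly_heavy_sq39U_24 p hp)
  · exact c025_core_six_heavy_cell_sq39u M p 25 17 1 1 39 0 1 10956 1000 31
      (by norm_num) (by norm_num) (by norm_num) (by norm_num) (by norm_num) (by norm_num) (by norm_num)
      (by norm_num [cnull]) (by norm_num [cnull]) (Or.inl (by norm_num)) (Or.inr (Or.inr (by norm_num))) (Or.inr rfl) (by norm_num) (by norm_num) (by norm_num)
      (Or.inr (tail_six_heavy_sq39U_25 (p + 25) (by omega))) hR hn hfree (level_six_poly_heavy_sq39U_25 p hp)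
  · exact c025_core_six_heavy_cell_sq39u M p 26 18 1 1 40 0 1 11125 1000 32
      (by norm_num) (by norm_num) (by norm_num) (by norm_num) (by norm_num) (by norm_num) (by norm_num)
      (by norm_num [cnull]) (by norm_num [cnull]) (Or.inl (by norm_num)) (Or.inr (Or.inr (by norm_num))) (Or.inr rfl) (by norm_num) (by norm_num) (by norm_num)
      (Or.inr (tail_six_heavy_sq39U_26 (p + 26) (by omega))) hR hn hfree (level_six_poly_heavy_sq39U_26 p hp)
  · exact c025_core_six_heavy_cell_sq39u M p 27 19 1 1 41 0 1 10027 1000 33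
      (by norm_num) (by norm_num) (by norm_num) (by norm_num) (by norm_num) (by norm_num) (by norm_num)
      (by norm_num [cnull]) (by norm_num [cnull]) (Or.inl (by norm_num)) (Or.inr (Or.inr (by norm_num))) (Or.inr rfl) (by norm_num) (by norm_num) (by norm_num)
      (Or.inr (tail_six_heavy_sq39U_27 (p + 27) (by omega))) hR hn hfree (level_six_poly_heavy_sq39U_27 p hp)
  · exact c025_core_six_heavy_cell_sq39u M p 28 20 1 1 42 0 1 8513 1000 34
      (by norm_num) (by norm_num) (by norm_num) (by norm_num) (by norm_num) (by norm_num) (by norm_num)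
      (by norm_num [cnull]) (by norm_num [cnull]) (Or.inl (by norm_num)) (Or.inr (Or.inr (by norm_num))) (Or.inr rfl) (by norm_num) (by norm_num) (by norm_num)
      (Or.inr (tail_six_heavy_sq39U_28 (p + 28) (by omega))) hR hn hfree (level_six_poly_heavy_sq39U_28 p hp)
  · exact c025_core_six_heavy_cell_sq39u M p 29 22 1 1 35 0 1 7082 1000 35
      (by norm_num) (by norm_num) (by norm_num) (by norm_num) (by norm_num) (by norm_num) (by norm_num)
      (by norm_num [cnull]) (by norm_num [cnull]) (Or.inr ⟨by norm_num, by norm_num⟩) (Or.inr (Or.inr (by norm_num))) (Or.inr rfl) (by norm_num) (by norm_num) (by norm_num)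
      (Or.inr (tail_six_heavy_sq39U_29 (p + 29) (by omega))) hR hn hfree (level_six_poly_heavy_sq39U_29 p hp)
  · exact c025_core_six_heavy_cell_sq39u M p 30 23 1 1 36 0 1 5888 1000 36
      (by norm_num) (by norm_num) (by norm_num) (by norm_num) (by norm_num) (by norm_num) (by norm_num)
      (by norm_num [cnull]) (by norm_num [cnull]) (Or.inr ⟨by norm_num, by norm_num⟩) (Or.inr (Or.inr (by norm_num))) (Or.inr rfl) (by norm_num) (by norm_num) (by norm_num)
      (Or.inr (tail_six_heavy_sq39U_30 (p + 30) (by omega))) hR hn hfree (level_six_poly_heavy_sq39U_30 p hp)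
  · exact c025_core_six_heavy_cell_sq39u M p 31 23 1 1 37 0 1 4935 1000 37
      (by norm_num) (by norm_num) (by norm_num) (by norm_num) (by norm_num) (by norm_num) (by norm_num)
      (by norm_num [cnull]) (by norm_num [cnull]) (Or.inr ⟨by norm_num, by norm_num⟩) (Or.inr (Or.inr (by norm_num))) (Or.inr rfl) (by norm_num) (by norm_num) (by norm_num)
      (Or.inr (tail_six_heavy_sq39U_31 (p + 31) (by omega))) hR hn hfree (level_six_poly_heavy_sq39U_31 p hp)
  · exact c025_core_six_heavy_cell_sq39u M p 32 24 1 1 38 0 1 4184 1000 38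
      (by norm_num) (by norm_num) (by norm_num) (by norm_num) (by norm_num) (by norm_num) (by norm_num)
      (by norm_num [cnull]) (by norm_num [cnull]) (Or.inr ⟨by norm_num, by norm_num⟩) (Or.inr (Or.inr (by norm_num))) (Or.inr rfl) (by norm_num) (by norm_num) (by norm_num)
      (Or.inr (tail_six_heavy_sq39U_32 (p + 32) (by omega))) hR hn hfree (level_six_poly_heavy_sq39U_32 p hp)
  · exact c025_core_six_heavy_cell_sq39u M p 33 24 1 1 39 0 1 3592 1000 39
      (by norm_num) (by norm_num) (by norm_num) (by norm_num) (by norm_num) (by norm_num) (by norm_num)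
      (by norm_num [cnull]) (by norm_num [cnull]) (Or.inr ⟨by norm_num, by norm_num⟩) (Or.inr (Or.inr (by norm_num))) (Or.inr rfl) (by norm_num) (by norm_num) (by norm_num)
      (Or.inr (tail_six_heavy_sq39U_33 (p + 33) (by omega))) hR hn hfree (level_six_poly_heavy_sq39U_33 p hp)
  · exact c025_core_six_heavy_cell_sq39u M p 34 25 1 1 39 0 1 3123 1000 39
      (by norm_num) (by norm_num) (by norm_num) (by norm_num) (by norm_num) (by norm_num) (by norm_num)
      (by norm_num [cnull]) (by norm_num [cnull]) (Or.inr ⟨by norm_num, by norm_num⟩) (Or.inr (Or.inr (by norm_num))) (Or.inr rfl) (by norm_num) (by norm_num) (by norm_num)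
      (Or.inr (tail_six_heavy_sq39U_34 (p + 34) (by omega))) hR hn hfree (level_six_poly_heavy_sq39U_34 p hp)
  · exact c025_core_six_heavy_cell_sq39u M p 35 25 1 1 39 0 1 2748 1000 39
      (by norm_num) (by norm_num) (by norm_num) (by norm_num) (by norm_num) (by norm_num) (by norm_num)
      (by norm_num [cnull]) (by norm_num [cnull]) (Or.inr ⟨by norm_num, by norm_num⟩) (Or.inr (Or.inr (by norm_num))) (Or.inr rfl) (by norm_num) (by norm_num) (by norm_num)
      (Or.inr (tail_six_heavy_sq39U_35 (p + 35) (by omega))) hR hn hfree (level_six_poly_heavy_sq39U_35 p hp)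
  · exact c025_core_six_heavy_cell_sq39u M p 36 26 1 1 39 0 1 2445 1000 39
      (by norm_num) (by norm_num) (by norm_num) (by norm_num) (by norm_num) (by norm_num) (by norm_num)
      (by norm_num [cnull]) (by norm_num [cnull]) (Or.inr ⟨by norm_num, by norm_num⟩) (Or.inr (Or.inr (by norm_num))) (Or.inr rfl) (by norm_num) (by norm_num) (by norm_num)
      (Or.inr (tail_six_heavy_sq39U_36 (p + 36) (by omega))) hR hn hfree (level_six_poly_heavy_sq39U_36 p hp)
  · exact c025_core_six_heavy_cell_sq39u M p 37 26 1 1 39 0 1 2200 1000 39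
      (by norm_num) (by norm_num) (by norm_num) (by norm_num) (by norm_num) (by norm_num) (by norm_num)
      (by norm_num [cnull]) (by norm_num [cnull]) (Or.inr ⟨by norm_num, by norm_num⟩) (Or.inr (Or.inr (by norm_num))) (Or.inr rfl) (by norm_num) (by norm_num) (by norm_num)
      (Or.inr (tail_six_heavy_sq39U_37 (p + 37) (by omega))) hR hn hfree (level_six_poly_heavy_sq39U_37 p hp)
  · exact c025_core_six_heavy_cell_sq39u M p 38 27 1 1 39 0 1 1999 1000 39
      (by norm_num) (by norm_num) (by norm_num) (by norm_num) (by norm_num) (by norm_num) (by norm_num)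
      (by norm_num [cnull]) (by norm_num [cnull]) (Or.inr ⟨by norm_num, by norm_num⟩) (Or.inr (Or.inr (by norm_num))) (Or.inr rfl) (by norm_num) (by norm_num) (by norm_num)
      (Or.inr (tail_six_heavy_sq39U_38 (p + 38) (by omega))) hR hn hfree (level_six_poly_heavy_sq39U_38 p hp)
  · exact c025_core_six_heavy_cell_sq39u M p 39 27 1 1 39 0 1 1834 1000 39
      (by norm_num) (by norm_num) (by norm_num) (by norm_num) (by norm_num) (by norm_num) (by norm_num)
      (by norm_num [cnull]) (by norm_num [cnull]) (Or.inr ⟨by norm_num, by norm_num⟩) (Or.inr (Or.inr (by norm_num))) (Or.inr rfl) (by norm_num) (by norm_num) (by norm_num)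
      (Or.inr (tail_six_heavy_sq39U_39 (p + 39) (by omega))) hR hn hfree (level_six_poly_heavy_sq39U_39 p hp)
  · exact c025_core_six_heavy_cell_sq39u M p 40 28 1 1 39 0 1 1697 1000 39
      (by norm_num) (by norm_num) (by norm_num) (by norm_num) (by norm_num) (by norm_num) (by norm_num)
      (by norm_num [cnull]) (by norm_num [cnull]) (Or.inr ⟨by norm_num, by norm_num⟩) (Or.inr (Or.inr (by norm_num))) (Or.inr rfl) (by norm_num) (by norm_num) (by norm_num)
      (Or.inr (tail_six_heavy_sq39U_40 (p + 40) (by omega))) hR hn hfree (level_six_poly_heavy_sq39U_40 p hp)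
  · exact c025_core_six_heavy_cell_sq39u M p 41 28 1 1 39 0 1 1584 1000 39
      (by norm_num) (by norm_num) (by norm_num) (by norm_num) (by norm_num) (by norm_num) (by norm_num)
      (by norm_num [cnull]) (by norm_num [cnull]) (Or.inr ⟨by norm_num, by norm_num⟩) (Or.inr (Or.inr (by norm_num))) (Or.inr rfl) (by norm_num) (by norm_num) (by norm_num)
      (Or.inr (tail_six_heavy_sq39U_41 (p + 41) (by omega))) hR hn hfree (level_six_poly_heavy_sq39U_41 p hp)
  · exact c025_core_six_heavy_cell_sq39u M p 42 29 1 1 39 0 1 1489 1000 39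
      (by norm_num) (by norm_num) (by norm_num) (by norm_num) (by norm_num) (by norm_num) (by norm_num)
      (by norm_num [cnull]) (by norm_num [cnull]) (Or.inr ⟨by norm_num, by norm_num⟩) (Or.inr (Or.inr (by norm_num))) (Or.inr rfl) (by norm_num) (by norm_num) (by norm_num)
      (Or.inr (tail_six_heavy_sq39U_42 (p + 42) (by omega))) hR hn hfree (level_six_poly_heavy_sq39U_42 p hp)
  · exact c025_core_six_heavy_cell_sq39u M p 43 29 1 1 39 0 1 1409 1000 39
      (by norm_num) (by norm_num) (by norm_num) (by norm_num) (by norm_num) (by norm_num) (by norm_num)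
      (by norm_num [cnull]) (by norm_num [cnull]) (Or.inr ⟨by norm_num, by norm_num⟩) (Or.inr (Or.inr (by norm_num))) (Or.inr rfl) (by norm_num) (by norm_num) (by norm_num)
      (Or.inr (tail_six_heavy_sq39U_43 (p + 43) (by omega))) hR hn hfree (level_six_poly_heavy_sq39U_43 p hp)
  · exact c025_core_six_heavy_cell_sq39u M p 44 30 1 1 39 0 1 1342 1000 39
      (by norm_num) (by norm_num) (by norm_num) (by norm_num) (by norm_num) (by norm_num) (by norm_num)
      (by norm_num [cnull]) (by norm_num [cnull]) (Or.inr ⟨by norm_num, by norm_num⟩) (Or.inr (Or.inr (by norm_num))) (Or.inr rfl) (by norm_num) (by norm_num) (by norm_num)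
      (Or.inr (tail_six_heavy_sq39U_44 (p + 44) (by omega))) hR hn hfree (level_six_poly_heavy_sq39U_44 p hp)
  · exact c025_core_six_heavy_cell_sq39u M p 45 30 1 1 39 0 1 1286 1000 39
      (by norm_num) (by norm_num) (by norm_num) (by norm_num) (by norm_num) (by norm_num) (by norm_num)
      (by norm_num [cnull]) (by norm_num [cnull]) (Or.inr ⟨by norm_num, by norm_num⟩) (Or.inr (Or.inr (by norm_num))) (Or.inr rfl) (by norm_num) (by norm_num) (by norm_num)
      (Or.inr (tail_six_heavy_sq39U_45 (p + 45) (by omega))) hR hn hfree (level_six_poly_heavy_sq39U_45 p hp)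
  · exact c025_core_six_heavy_cell_sq39u M p 46 31 1 1 39 0 1 1238 1000 39
      (by norm_num) (by norm_num) (by norm_num) (by norm_num) (by norm_num) (by norm_num) (by norm_num)
      (by norm_num [cnull]) (by norm_num [cnull]) (Or.inr ⟨by norm_num, by norm_num⟩) (Or.inr (Or.inr (by norm_num))) (Or.inr rfl) (by norm_num) (by norm_num) (by norm_num)
      (Or.inr (tail_six_heavy_sq39U_46 (p + 46) (by omega))) hR hn hfree (level_six_poly_heavy_sq39U_46 p hp)
  · exact c025_core_six_heavy_cell_sq39u M p 47 31 1 1 39 0 1 1198 1000 39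
      (by norm_num) (by norm_num) (by norm_num) (by norm_num) (by norm_num) (by norm_num) (by norm_num)
      (by norm_num [cnull]) (by norm_num [cnull]) (Or.inr ⟨by norm_num, by norm_num⟩) (Or.inr (Or.inr (by norm_num))) (Or.inr rfl) (by norm_num) (by norm_num) (by norm_num)
      (Or.inr (tail_six_heavy_sq39U_47 (p + 47) (by omega))) hR hn hfree (level_six_poly_heavy_sq39U_47 p hp)
  · exact c025_core_six_heavy_cell_sq39u M p 48 32 1 1 39 0 1 1165 1000 39
      (by norm_num) (by norm_num) (by norm_num) (by norm_num) (by norm_num) (by norm_num) (by norm_num)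
      (by norm_num [cnull]) (by norm_num [cnull]) (Or.inr ⟨by norm_num, by norm_num⟩) (Or.inr (Or.inr (by norm_num))) (Or.inr rfl) (by norm_num) (by norm_num) (by norm_num)
      (Or.inr (tail_six_heavy_sq39U_48 (p + 48) (by omega))) hR hn hfree (level_six_poly_heavy_sq39U_48 p hp)
  · exact c025_core_six_heavy_cell_sq39u M p 49 32 1 1 39 0 1 1136 1000 39
      (by norm_num) (by norm_num) (by norm_num) (by norm_num) (by norm_num) (by norm_num) (by norm_num)
      (by norm_num [cnull]) (by norm_num [cnull]) (Or.inr ⟨by norm_num, by norm_num⟩) (Or.inr (Or.inr (by norm_num))) (Or.inr rfl) (by norm_num) (by norm_num) (by norm_num)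
      (Or.inr (tail_six_heavy_sq39U_49 (p + 49) (by omega))) hR hn hfree (level_six_poly_heavy_sq39U_49 p hp)
  · exact c025_core_six_heavy_cell_sq39u M p 50 33 1 1 39 0 1 1113 1000 39
      (by norm_num) (by norm_num) (by norm_num) (by norm_num) (by norm_num) (by norm_num) (by norm_num)
      (by norm_num [cnull]) (by norm_num [cnull]) (Or.inr ⟨by norm_num, by norm_num⟩) (Or.inr (Or.inr (by norm_num))) (Or.inr rfl) (by norm_num) (by norm_num) (by norm_num)
      (Or.inr (tail_six_heavy_sq39U_50 (p + 50) (by omega))) hR hn hfree (level_six_poly_heavy_sq39U_50 p hp)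

/-- **THEOREM C₆ ON THE FLAT BOUNDS `39 / 19`, LEMMA T⁺⁺, THE FLAT-COUNT TAIL AND THE UNIQUE HEAVY FLAT, GIVEN LEVEL `5`**:
level `5` for all `p ≥ 38` implies level `6` for all `p ≥ 39`. -/
theorem c025_six_of_five_heavy_sq39u (h5 : ∀ (M : Matroid α) [M.Finite] (p : ℕ), 38 ≤ p → RLS M p 5) :
    ∀ (M : Matroid α) [M.Finite] (p : ℕ), 39 ≤ p → RLS M p 6 := by
  intro M _ p hp
  rcases Nat.lt_or_ge p 40 with hlt | hge
  · have hP : p = 39 := by omega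
    subst hP
    refine rls_six_at_of_core 39 (by norm_num) (fun M _ => h5 M 38 (by norm_num)) ?_ M
    intro M _ d hd hR hn hfree
    rcases Nat.lt_or_ge d 51 with hd50 | hd51
    · exact c025_core_six_bounded_corank_heavy_sq39u M 39 d (by norm_num) hd (by omega) hR hn hfree
    · exact c025_core_six_thirtynine_thirtyeight' M 39 (by norm_num) hR (by omega) hfree
  · refine rls_succ_large (α := α) 5 6 39 ?_ ?_ ?_ M p hge (by omega)
    · intro M' _ p' hP _
      exact h5 M' p' (by omega)
    · intro M' _ p' _ hn _
      rcases Nat.lt_or_ge M'.E.ncard (p' + 6) with h | h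
      · exact RLS_of_ncard_lt M' h
      · exact RLS_of_ncard_eq M' (by omega)
    · intro M' _ p' hP hR hbig _ hfree
      rcases Nat.lt_or_ge M'.E.ncard (p' + 51) with h | h
      · exact c025_core_six_bounded_corank_heavy_sq39u M' p' (M'.E.ncard - p') hP (by omega) (by omega) hR (by omega) hfree
      · exact c025_core_six_thirtynine_thirtyeight' M' p' (by omega) hR (by omega) hfree

/-- **C-025 AT LEVEL `6` FOR EVERY `p ≥ 39`, EVERY FINITE MATROID, UNCONDITIONAL** — `c025_six_of_five_heavy_sq39u` on
p7's level-`5` row `c025_five_large_part33 (33 ≤ p)`. -/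
theorem c025_six_large_thirty_nine (M : Matroid α) [M.Finite] (p : ℕ) (hp : 39 ≤ p) : RLS M p 6 :=
  c025_six_of_five_heavy_sq39u (fun M _ p hp => c025_five_large_part33 M p (by omega)) M p hp

/-- The same in the vocabulary of `C025`: the level-`6` frontier of the counting route is every `p ≥ 39`. -/
theorem c025_six_large_thirty_nine' (M : Matroid α) [M.Finite] (p : ℕ) (hp : 39 ≤ p) :
    phiK p 6 * ({A : Set α | A ⊆ M.E ∧ M.eRk A = (p : ℕ∞) ∧ M.eRk (M.E \ A) = (6 : ℕ∞)}.ncard : ℚ) ≤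
      ({A : Set α | A ⊆ M.E ∧ (6 : ℕ∞) < M.eRk A ∧ M.eRk A < (p : ℕ∞)}.ncard : ℚ) :=
  c025_six_large_thirty_nine M p hp

end ThmN

end PercRepro
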